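import Literature.MathematicalPhysics.QuantumFieldTheory.Balaban1983to89.B8Prop7HalfSpace

/-!
# `Balaban1983to89.B8Eq1126AxialWitness` — [Balaban1985RegularSpaces] Sect. F p. 97, the sentence after (1.127): «It is
# achieved by applying a gauge transformation u₀ satisfying the conditions u₀(y) = 1 for y ∈ 𝔅_k, hence the configuration
# U₀^{u₀⁻¹} satisfies (1.126)» — a KERNEL WITNESS (cell GAPS G-B8-18) that the «hence» FAILS AS PRINTED under the p. 77 bond
# convention, on the half-space family of `B8Prop7HalfSpace` (`k = 1`, `G = U(1) ⊂ ℂ`), with the two transfer lemmas locating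
# the failure on the level-0 bonds leaving `Λ₀` only (a convention clash p. 77 / (1.31); constants-only repair in the cell)

statement-level skeleton of published theorems with citation tags; proofs where landed; nothing here is a claim about the Yang–Mills mass gap

CITATION HEADER.  [Balaban1985RegularSpaces] T. Bałaban, *Spaces of regular gauge field configurations on a lattice and gauge
fixing conditions*, Commun. Math. Phys. **99** (1985) 75–102: Sect. F p. 97 [PDF 23]; (1.126) p. 97; (1.12)–(1.15) p. 78; bond
convention p. 77; (1.31) p. 82; (1.7), (1.9) p. 77.  [Balaban1985Averaging] (= [3]): (8) p. 18, (11) p. 19 / p. 24, (43) p. 24.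
Text read from the materialised pages of `paper:balaban1985-cmp99-regular-spaces-gauge-fixing`.

WHAT IS PRINTED (p. 97).  «At first let us notice that if α₀ + α₁ ≤ c₁ and |Ū₀ʲ − 1| < α₁ on Λ_j, j = 0, 1, …, k, (1.126) then
Theorem 2 implies that there exists a gauge transformation u such that … (1.127).  We have to transform U₀ into a
configuration satisfying the axial gauge conditions (1.15), i.e. we get a configuration belonging to Ax_k(𝔅_k, 1).  It is
achieved by applying a gauge transformation u₀ satisfying the conditions u₀(y) = 1 for y ∈ 𝔅_k, hence the configuration
U₀^{u₀⁻¹} satisfies (1.126).  Then we apply Theorem 2 to the configurations U₀^{u₀⁻¹}, 1 in the place of U′U₀, U₀, and we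
get (1.127).»  Here `𝔅_k = ⋃_{j=0}^{k} Λ_j` (1.12); «u(y) = 1 for y ∈ 𝔅_k» is (1.14) (p. 78: (1.15) «together with (1.14) …
determine uniquely an element in each orbit»); «on Λ_j» is read with p. 77: «If Ω ⊂ T then we denote by Ω also the set of
bonds ⋃_{x∈Ω} st(x) = {bonds b ⊂ T : at least one end-point of b belongs to Ω} … This convention applies to an arbitrary
lattice» — the tree's `B8Ineq132.BondTouches` (used by (1.7)–(1.9) `B8Ineq132.InAk` and by `B8Ineq145Lineage.lineageGF7`).

WHAT IS KERNEL-CHECKED (family `Ω₀ = ℤᵈ ⊃ Ω₁ = {x : 0 ≤ x_{i₀}}`, `k = 1`, `Λ₁ = {z : 0 ≤ z_{i₀}}` (sites of the `L`-lattice),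
`Λ₀ = {x : x_{i₀} < 0}` — `B8Ineq145Lineage.Lam i₀`; `L ≥ 2`; a second direction `i₁ ≠ i₀`):
* §1 typed sentences: `Holds126 L k Λ α₁ U` = (1.126) with the p. 77 convention; `Fixes114 L k Λ u` = (1.14) (`u(Lʲy) = 1`,
  `y ∈ Λ_j`, the tree's `uLev`); `Ax_1(𝔅_1, 1)` is the tree's `B8Eq119TwistedAxial.InAx L 1 Λ 1` (= (1.15), `inAx_one_iff`).
* §2 TRANSFER LEMMAS (any `U₀`): under (1.14), `U₀^{u₀⁻¹} = U₀` on the level-0 bonds with BOTH end-points in `Λ₀`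
  (`interior_zero_transfer`), and `(U₀^{u₀⁻¹})‾¹ = Ū₀¹` on EVERY level-1 bond touching `Λ₁`, interior or crossing, by (11) of [3]
  (`avgIter_one_transfer`, under the Prop. 2 smallness of [3] carried by `B7AvgGaugeCovariance.avgIter_gaugeAct`).  So the
  «hence» can fail only on the level-0 bonds `⟨x, x + e_{i₀}⟩`, `x_{i₀} = −1` (exactly one end-point in `Λ₀`).
* §3–§4 THE WITNESS that it does fail there: `U₀ = 1^{g_a}`, `g_a(x) = e^{i a m(x)}`, `m(x) = (2 − |x_{i₀} + 1| − |x_{i₁} − 1|)⁺`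
  (`prof`), `0 < a ≤ 1`, `α₁(a) = (|e^{ia} − 1| + |e^{2ia} − 1|)/2 < 3a/2` (`alpha1`): `U₀` is `U(1)`-valued, lies in
  `𝔄_k({Ω_j}, α₀)` for EVERY `α₀ > 0` and every family (pure gauge), satisfies (1.126) at `α₁(a)` (`holds126_U0`:
  `|m(b₋) − m(b₊)| ≤ 1`, and `Ū₀¹ = 1` by (11) of [3] since `m(Lz) = 0`); `u₀` with (1.14) and `U₀^{u₀⁻¹} ∈ Ax_1(𝔅_1, 1)` EXIST
  (`exists_fixed`); and for EVERY such `u₀` the level-0 clause of (1.126) fails for `U₀^{u₀⁻¹}` on `b* = ⟨e_{i₁} − e_{i₀}, e_{i₁}⟩`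
  (`b*₋ ∈ Λ₀`): `|U₀^{u₀⁻¹}(b*) − 1| = |e^{2ia} − 1| > α₁(a)` (`norm_crossing_eq`, `not_holds126_fixed`), because (1.15) in the
  block of `0 ∈ Λ₁` pins `u₀⁻¹(e_{i₁}) = g_a(e_{i₁})⁻¹`.  Headline `p97_transfer_fails`: for every `ε > 0` a witness with `α₁ < ε`.

HONEST SCOPE.  (i) This refutes the quoted «hence» AS PRINTED under the p. 77 convention only; with the narrower bond sets of
(1.31) p. 82 («b ⊂ Λ_j (i.e., b₋, b₊ ∈ Λ_j)» plus the crossing bonds «b₋ ∈ Λ_{j−1}, b₊ ∈ Λ_j») the sentence is TRUE (§2, given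
(11)) — the cell records G-B8-18 as a located convention clash with a constants-only repair (`α₁ ↦ O(dL)α₁ + O(d)α₀L^{−2j}`;
(1.127) keeps its shape), sibling of G-B8-01 ((1.145), `B8Ineq145Lineage`).  (ii) Carriers: the lineage's `ℤᵈ` model of
`T_η` (`η` enters only (1.9), which holds with left side `0` here); `G = U(1)` = the unitary group of `ℂ`; `U₀^{u₀⁻¹}` is
`B7Prop1Explicit.gaugeAct u₀⁻¹ U₀` ((8) of [3]) — the failure being proved for every `u₀` with (1.14), the exponent
convention is immaterial.  (iii) Nothing here bears on Theorem 2, (1.127) or Proposition 6 beyond the constant in the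
hypothesis (1.35) they are fed with.
-/

namespace Literature.MathematicalPhysics.QuantumFieldTheory.Balaban1983to89.B8Eq1126AxialWitness

open B7Prop1Explicit B7Prop2Explicit B7AvgGaugeCovariance
open B8Ineq130 (hol_one axialFn_one)
open B8Ineq132 (InAk BondTouches InAxOne avgIter_one inAk_gaugeAct_iff)
open B8Prop6OfThm4 (one_inAk)
open B8Eq115GaugeFixing (axialFn_gaugeAct)
open B8Eq119TwistedAxial (InAx inAx_one_iff)
open B8Eq131Derivation (under_zero_iff)
open B8Ineq145Lineage (Lam mem_Lam_zero mem_Lam_one)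
open B8Prop7HalfSpace (OmegaHS bondTouches_lam_one)
open Complex (I)

-- `Site` alone would resolve to the torus sites of `Setup.lean`; re-export the `ℤ^d` sites of `B7Prop1Explicit`.
export B7Prop1Explicit (Site)

variable {d : ℕ}

/-! ## §1 The typed sentences: (1.126) with the p. 77 convention, (1.14) -/

section Typed

variable {G : Type*}

/-- **(1.14)** «u(y) = 1 for y ∈ 𝔅_k», `𝔅_k = ⋃_{j=0}^{k} Λ_j` (1.12): the sites `y ∈ Λ_j` of the `Lʲ`-lattice are the
points `Lʲy` of the fine lattice, so the condition reads `u(Lʲy) = 1` — the tree's `u_j(y) = u(Lʲy)`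
(`B7AvgGaugeCovariance.uLev`). [cite: Balaban1985RegularSpaces, (1.14) p.78, (1.12) p.78] -/
def Fixes114 (L k : ℕ) (Λ : ℕ → Set (Site d)) [One G] (u : Site d → G) : Prop :=
  ∀ j, j ≤ k → ∀ y ∈ Λ j, uLev L u j y = 1

variable {𝔸 : Type*} [NormedRing 𝔸] [NormedAlgebra ℂ 𝔸] [CompleteSpace 𝔸]

/-- **(1.126)** «|Ū₀ʲ − 1| < α₁ on Λ_j, j = 0, 1, …, k» — `Ū₀ʲ` the `j`-fold average (43) of [3]
(`B7Prop2Explicit.avgIter`), «on Λ_j» = the level-`j` bonds with at least one end-point in `Λ_j` (p. 77 convention,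
`B8Ineq132.BondTouches`). [cite: Balaban1985RegularSpaces, (1.126) p.97, p.77 (bond convention)] -/
def Holds126 (L k : ℕ) (Λ : ℕ → Set (Site d)) (α₁ : ℝ) (U : Site d → Fin d → 𝔸ˣ) : Prop :=
  ∀ j, j ≤ k → ∀ (z : Site d) (κ : Fin d), BondTouches (Λ j) z κ → ‖((avgIter L U j z κ : 𝔸ˣ) : 𝔸) - 1‖ < α₁

end Typed

/-! ## §2 The transfer lemmas: where the «hence» holds -/

section Transfer

/-- `(u·w)`-action: `(V^{w})^{u} = V^{uw}` ((8) of [3]). [folklore] -/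
private theorem gaugeAct_mul {G : Type*} [Group G] (u w : Site d → G) (V : Site d → Fin d → G) :
    gaugeAct u (gaugeAct w V) = gaugeAct (u * w) V := by
  funext x μ
  simp only [gaugeAct, Pi.mul_apply, mul_inv_rev, mul_assoc]

/-- `(Lz)_{i₀} ≥ 0` for `z_{i₀} ≥ 0`. [folklore] -/
private theorem smul_apply_nonneg {L : ℕ} {i₀ : Fin d} {z : Site d} (hz : 0 ≤ z i₀) : 0 ≤ ((L : ℤ) • z) i₀ := by
  simp only [Pi.smul_apply, smul_eq_mul]
  positivity

/-- `(z + e_κ)_{i₀} ≥ 0` for `z_{i₀} ≥ 0`. [folklore] -/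
private theorem add_e_apply_nonneg {i₀ : Fin d} {z : Site d} (hz : 0 ≤ z i₀) (κ : Fin d) : 0 ≤ (z + e κ) i₀ := by
  simp only [Pi.add_apply, e_apply]
  split_ifs <;> omega

/-- **Level 0, both end-points in `Λ₀`**: `U₀^{u₀⁻¹}(b) = u₀(b₋)⁻¹U₀(b)u₀(b₊) = U₀(b)` by (1.14) — the sentence of p. 78
after (1.13) («(Ū_j^u)_b = u(b₋)(Ū_j)_b u⁻¹(b₊) for b ⊂ T^{(j)}»). [cite: Balaban1985RegularSpaces, p.78 (sentence after (1.13)), (1.14) p.78] -/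
theorem interior_zero_transfer {G : Type*} [Group G] {L : ℕ} {i₀ : Fin d} (U₀ : Site d → Fin d → G)
    {u₀ : Site d → G} (h14 : Fixes114 L 1 (Lam i₀) u₀) {x : Site d} {κ : Fin d} (hx : x ∈ Lam i₀ 0)
    (hx' : x + e κ ∈ Lam i₀ 0) : gaugeAct u₀⁻¹ U₀ x κ = U₀ x κ := by
  have h1 : u₀ x = 1 := by simpa [uLev] using h14 0 (Nat.zero_le 1) x hx
  have h2 : u₀ (x + e κ) = 1 := by simpa [uLev] using h14 0 (Nat.zero_le 1) (x + e κ) hx'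
  simp [gaugeAct, h1, h2]

variable {𝔸 : Type*} [NormedRing 𝔸] [NormOneClass 𝔸] [NormedAlgebra ℂ 𝔸] [CompleteSpace 𝔸]

/-- **Level 1, every bond touching `Λ₁`** (interior: both ends at points `Lz`, `L(z + e_κ)` of `L·Λ₁`; crossing
`⟨z, z + e_{i₀}⟩`, `z_{i₀} = −1`, (1.31): `Lz ∈ Λ₀`): `(U₀^{u₀⁻¹})‾¹_b = u₀(Lb₋)⁻¹ Ū₀¹_b u₀(Lb₊) = Ū₀¹_b` by the covariance
(11) of [3] (`B7AvgGaugeCovariance.avgIter_gaugeAct`, available under the Prop. 2 smallness of [3]) and (1.14).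
[cite: Balaban1985RegularSpaces, p.78 (sentence after (1.13)), (1.14) p.78, (1.31) p.82; Balaban1985Averaging, (11) p.19, p.24] -/
theorem avgIter_one_transfer {L : ℕ} (hL : 2 ≤ L) {i₀ : Fin d} {G : Subgroup 𝔸ˣ} (hG : AvgClosed d L G)
    {U₀ : Site d → Fin d → 𝔸ˣ} (hU : ∀ x κ, U₀ x κ ∈ G) {u₀ : Site d → 𝔸ˣ} (hu : ∀ x, u₀ x ∈ U1 𝔸)
    {α₀ : ℝ} (hα : 0 < α₀) (hα3 : C0 d * α₀ ≤ 1 / 3) (hα2 : 2 * α₀ ≤ c2' d L)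
    (h52 : pdev U₀ < α₀ * (((L : ℝ) ^ 1)⁻¹) ^ 2) (h14 : Fixes114 L 1 (Lam i₀) u₀) {z : Site d} {κ : Fin d}
    (hb : BondTouches (Lam i₀ 1) z κ) : avgIter L (gaugeAct u₀⁻¹ U₀) 1 z κ = avgIter L U₀ 1 z κ := by
  have hu' : ∀ x, u₀⁻¹ x ∈ U1 𝔸 := fun x => (U1 𝔸).inv_mem (hu x)
  rw [avgIter_gaugeAct L hL hG 1 U₀ hU hu' hα hα3 hα2 h52 1 le_rfl]
  -- the two end values `u₀(Lz) = 1`, `u₀(L(z + e_κ)) = 1`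
  have hends : u₀ ((L : ℤ) • z) = 1 ∧ u₀ ((L : ℤ) • (z + e κ)) = 1 := by
    rcases bondTouches_lam_one hb with hz | ⟨hz, hκ⟩
    · exact ⟨by simpa [uLev] using h14 1 le_rfl z ((mem_Lam_one i₀ z).2 hz),
        by simpa [uLev] using h14 1 le_rfl (z + e κ) ((mem_Lam_one i₀ _).2 (add_e_apply_nonneg hz κ))⟩
    · -- crossing bond: `Lz ∈ Λ₀`, `z + e_{i₀} ∈ Λ₁`
      subst hκ
      refine ⟨?_, ?_⟩
      · have hmem : (L : ℤ) • z ∈ Lam κ 0 := by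
          rw [mem_Lam_zero]
          simp only [Pi.smul_apply, smul_eq_mul, hz]
          have : (2 : ℤ) ≤ L := by exact_mod_cast hL
          linarith
        simpa [uLev] using h14 0 (Nat.zero_le 1) _ hmem
      · have hmem : z + e κ ∈ Lam κ 1 := by
          rw [mem_Lam_one]
          simp [Pi.add_apply, e_apply, hz]
        simpa [uLev] using h14 1 le_rfl _ hmem
  simp only [gaugeAct, uLev, pow_one, Pi.inv_apply, hends.1, hends.2, inv_one, one_mul, mul_one]

end Transfer

/-! ## §3 `U(1)` phases and the witness -/

section Phase

/-- `e^{iθ}` as a unit of `ℂ` — the elements of the gauge group `G = U(1)` (the case `N = 1` of `G ⊂ U(N)`).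
[cite: Balaban1985RegularSpaces, p.76 (the gauge group G); Balaban1985Averaging, (19) p.21] -/
noncomputable def ph (θ : ℝ) : ℂˣ := Units.mk0 (Complex.exp (I * θ)) (Complex.exp_ne_zero _)

/-- `val_ph`. [folklore] -/
@[simp] private theorem val_ph (θ : ℝ) : ((ph θ : ℂˣ) : ℂ) = Complex.exp (I * θ) := rfl

/-- `e^{i0} = 1`. [folklore] -/
private theorem ph_zero : ph 0 = 1 := Units.ext (by simp)

/-- `e^{is}(e^{it})⁻¹ = e^{i(s−t)}`. [folklore] -/
private theorem ph_mul_inv (s t : ℝ) : ph s * (ph t)⁻¹ = ph (s - t) := by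
  apply Units.ext
  rw [Units.val_mul, Units.val_inv_eq_inv_val, val_ph, val_ph, val_ph, ← Complex.exp_neg, ← Complex.exp_add]
  push_cast
  ring_nf

/-- `e^{iθ} ∈ U(1)` = the unitary group of `ℂ` (`|e^{iθ}| = 1`). [folklore] -/
private theorem ph_mem_unitaryUnits (θ : ℝ) : ph θ ∈ unitaryUnits ℂ := by
  have h1 : ‖((ph θ : ℂˣ) : ℂ)‖ = 1 := by rw [val_ph, mul_comm, Complex.norm_exp_ofReal_mul_I]
  rw [mem_unitaryUnits, Unitary.mem_iff, Complex.star_def, Complex.conj_mul', Complex.mul_conj', h1]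
  simp

/-- `e^{iθ} ∈ {|u| ≤ 1, |u⁻¹| ≤ 1}`. [folklore] -/
private theorem ph_mem_U1 (θ : ℝ) : ph θ ∈ U1 ℂ := unitaryUnits_le_U1 (ph_mem_unitaryUnits θ)

/-- `|e^{iθ} − 1| = 2|sin(θ/2)|`. [folklore] -/
private theorem norm_ph_sub_one (θ : ℝ) : ‖((ph θ : ℂˣ) : ℂ) - 1‖ = 2 * |Real.sin (θ / 2)| := by
  rw [val_ph, Complex.norm_exp_I_mul_ofReal_sub_one, Real.norm_eq_abs, abs_mul, abs_two]

/-- `|e^{−iθ} − 1| = |e^{iθ} − 1|`. [folklore] -/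
private theorem norm_ph_neg_sub_one (θ : ℝ) : ‖((ph (-θ) : ℂˣ) : ℂ) - 1‖ = ‖((ph θ : ℂˣ) : ℂ) - 1‖ := by
  rw [norm_ph_sub_one, norm_ph_sub_one, neg_div, Real.sin_neg, abs_neg]

/-- `|e^{ia} − 1| < |e^{2ia} − 1|` for `0 < a ≤ 1` (`sin a = 2 sin(a/2) cos(a/2)`, `cos(a/2) ≥ 7/8`). [folklore] -/
private theorem norm_ph_lt {a : ℝ} (ha : 0 < a) (ha1 : a ≤ 1) :
    ‖((ph a : ℂˣ) : ℂ) - 1‖ < ‖((ph (2 * a) : ℂˣ) : ℂ) - 1‖ := by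
  rw [norm_ph_sub_one, norm_ph_sub_one, show 2 * a / 2 = 2 * (a / 2) by ring, Real.sin_two_mul]
  have hs : 0 < Real.sin (a / 2) :=
    Real.sin_pos_of_pos_of_lt_pi (by positivity) (by linarith [Real.pi_gt_three])
  have hc : 7 / 8 ≤ Real.cos (a / 2) := by
    have := Real.one_sub_sq_div_two_le_cos (x := a / 2)
    nlinarith
  rw [abs_of_pos hs, abs_of_pos (by positivity)]
  nlinarith

end Phase

section Witness

variable (i₀ i₁ : Fin d)

/-- The plane profile `f(a, b) = (2 − |a + 1| − |b − 1|)⁺ ∈ {0, 1, 2}`, written out: `2` at `(a, b) = (−1, 1)`, `1` at its four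
neighbours `(−2, 1), (0, 1), (−1, 0), (−1, 2)`, `0` elsewhere. [cite: Balaban1985RegularSpaces, p.97 (sentence after (1.127)) — witness data] -/
def prof₂ (a b : ℤ) : ℤ :=
  if a = -1 ∧ b = 1 then 2
  else if (a = -2 ∧ b = 1) ∨ (a = 0 ∧ b = 1) ∨ (a = -1 ∧ b = 0) ∨ (a = -1 ∧ b = 2) then 1
  else 0

/-- The integer profile `m(x) = (2 − |x_{i₀} + 1| − |x_{i₁} − 1|)⁺ ∈ {0, 1, 2}`, written out: `2` at `(x_{i₀}, x_{i₁}) = (−1, 1)`,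
`1` at the four neighbours `(−2, 1), (0, 1), (−1, 0), (−1, 2)`, `0` elsewhere; it is `2` at `x* = e_{i₁} − e_{i₀}`, changes by
at most `1` along every bond, vanishes at `0` and on `L·ℤᵈ` (`L ≥ 2`). [cite: Balaban1985RegularSpaces, p.97 (sentence after (1.127)) — witness data] -/
def prof (x : Site d) : ℤ := prof₂ (x i₀) (x i₁)

/-- The gauge function `g_a(x) = e^{i a m(x)} ∈ U(1)`. [cite: Balaban1985RegularSpaces, p.97 (sentence after (1.127)) — witness data] -/
noncomputable def gw (a : ℝ) (x : Site d) : ℂˣ := ph (a * (prof i₀ i₁ x : ℝ))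

/-- **The witness** `U₀ = 1^{g_a}`, i.e. `U₀(x, x + e_κ) = g_a(x) g_a(x + e_κ)⁻¹ = e^{ia(m(x) − m(x + e_κ))}` (a pure gauge,
(8) of [3]). [cite: Balaban1985RegularSpaces, p.97 (sentence after (1.127)) — witness data; Balaban1985Averaging, (8) p.18] -/
noncomputable def U0 (a : ℝ) : Site d → Fin d → ℂˣ := gaugeAct (gw i₀ i₁ a) 1

/-- The constant `α₁(a) = (|e^{ia} − 1| + |e^{2ia} − 1|)/2` of (1.126) for the witness. [cite: Balaban1985RegularSpaces, (1.126) p.97 — witness data] -/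
noncomputable def alpha1 (a : ℝ) : ℝ := (‖((ph a : ℂˣ) : ℂ) - 1‖ + ‖((ph (2 * a) : ℂˣ) : ℂ) - 1‖) / 2

/-- The lower end-point `x* = e_{i₁} − e_{i₀}` of the violating level-0 bond `b* = ⟨x*, x* + e_{i₀}⟩ = ⟨e_{i₁} − e_{i₀}, e_{i₁}⟩`
(`x*_{i₀} = −1`: `x* ∈ Λ₀`; `e_{i₁} ∈ B(0)`, `0 ∈ Λ₁`, not a point of `L·Λ₁`). [cite: Balaban1985RegularSpaces, p.97 (sentence after (1.127)) — witness data] -/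
def xstar : Site d := e i₁ - e i₀

variable {i₀ i₁}

/-- `f` is `1`-Lipschitz along the unit steps it is asked about. [folklore] -/
private theorem prof₂_step (a b a' b' : ℤ)
    (h : (a' = a ∧ b' = b) ∨ (a' = a + 1 ∧ b' = b) ∨ (a' = a ∧ b' = b + 1) ∨ (a' = a + 1 ∧ b' = b + 1 ∧ a = b)) :
    prof₂ a b - prof₂ a' b' = -1 ∨ prof₂ a b - prof₂ a' b' = 0 ∨ prof₂ a b - prof₂ a' b' = 1 := by
  unfold prof₂
  split_ifs <;> omega

/-- `f(a, b) = 0` off `a = −1`, `b = 1`. [folklore] -/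
private theorem prof₂_eq_zero {a b : ℤ} (ha : a ≠ -1) (hb : b ≠ 1) : prof₂ a b = 0 := by
  unfold prof₂
  split_ifs <;> omega

/-- `|m(x) − m(x + e_κ)| ≤ 1`. [folklore] -/
private theorem prof_step (x : Site d) (κ : Fin d) :
    prof i₀ i₁ x - prof i₀ i₁ (x + e κ) = -1 ∨ prof i₀ i₁ x - prof i₀ i₁ (x + e κ) = 0 ∨
      prof i₀ i₁ x - prof i₀ i₁ (x + e κ) = 1 := by
  unfold prof
  refine prof₂_step _ _ _ _ ?_
  simp only [Pi.add_apply, e_apply]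
  by_cases h0 : i₀ = κ <;> by_cases h1 : i₁ = κ <;> simp [h0, h1]

/-- `m(0) = 0`. [folklore] -/
private theorem prof_zero : prof i₀ i₁ (0 : Site d) = 0 := by
  simp [prof, prof₂]

/-- `m(Lz) = 0` for `L ≥ 2` (`Lz_{i₀} ≠ −1`, `Lz_{i₁} ≠ 1`). [folklore] -/
private theorem prof_smul {L : ℕ} (hL : 2 ≤ L) (z : Site d) : prof i₀ i₁ ((L : ℤ) • z) = 0 := by
  have hL' : (2 : ℤ) ≤ L := by exact_mod_cast hL
  have h1 : (L : ℤ) * z i₀ ≠ -1 := by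
    intro h
    have h' : (L : ℤ) * (-z i₀) = 1 := by linarith
    have := Int.eq_one_of_mul_eq_one_right (by positivity) h'
    omega
  have h2 : (L : ℤ) * z i₁ ≠ 1 := fun h => by
    have := Int.eq_one_of_mul_eq_one_right (by positivity) h
    omega
  simp only [prof, Pi.smul_apply, smul_eq_mul]
  exact prof₂_eq_zero h1 h2

/-- `x*_{i₀} = −1`, `x*_{i₁} = 1`. [folklore] -/
private theorem xstar_apply (hi : i₀ ≠ i₁) : xstar i₀ i₁ i₀ = -1 ∧ xstar i₀ i₁ i₁ = 1 := by
  constructor <;> simp [xstar, e_apply, hi, Ne.symm hi]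

/-- `m(x*) = 2`. [folklore] -/
private theorem prof_xstar (hi : i₀ ≠ i₁) : prof i₀ i₁ (xstar i₀ i₁) = 2 := by
  simp [prof, prof₂, (xstar_apply hi).1, (xstar_apply hi).2]

/-- `x* + e_{i₀} = e_{i₁}`. [folklore] -/
private theorem xstar_add_e : xstar i₀ i₁ + e i₀ = e i₁ := sub_add_cancel _ _

/-- `x* ∈ Λ₀` (`x*_{i₀} = −1`). [cite: Balaban1985RegularSpaces, (1.5)–(1.6) p.77] -/
theorem xstar_mem (hi : i₀ ≠ i₁) : xstar i₀ i₁ ∈ Lam i₀ 0 := by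
  rw [mem_Lam_zero, (xstar_apply hi).1]
  norm_num

/-- `0 ∈ Λ₁`. [folklore] -/
private theorem zero_mem_Lam_one : (0 : Site d) ∈ Lam i₀ 1 := (mem_Lam_one i₀ 0).2 le_rfl

/-- The block vector `r* ∈ [0, L)ᵈ` with `boxVec L r* = e_{i₁}` (`L ≥ 2`). [folklore] -/
private def rstar {L : ℕ} (hL : 2 ≤ L) (i₁ : Fin d) : Fin d → Fin L :=
  fun κ => if κ = i₁ then ⟨1, by omega⟩ else ⟨0, by omega⟩

/-- `boxVec L r* = e_{i₁}`. [folklore] -/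
private theorem boxVec_rstar {L : ℕ} (hL : 2 ≤ L) (i₁ : Fin d) : boxVec L (rstar hL i₁) = e i₁ := by
  funext κ
  simp only [boxVec, rstar, e_apply]
  split_ifs <;> simp

/-- `U₀(x, x + e_κ) = e^{ia(m(x) − m(x + e_κ))}`. [cite: Balaban1985Averaging, (8) p.18] -/
theorem U0_apply (a : ℝ) (x : Site d) (κ : Fin d) :
    U0 i₀ i₁ a x κ = ph (a * ((prof i₀ i₁ x : ℝ) - prof i₀ i₁ (x + e κ))) := by
  simp only [U0, gaugeAct, gw, Pi.one_apply, mul_one, ph_mul_inv]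
  congr 1
  ring

/-- `g_a` is `U(1)`-valued. [cite: Balaban1985RegularSpaces, p.76 (gauge group G)] -/
theorem gw_mem_unitaryUnits (a : ℝ) (x : Site d) : gw i₀ i₁ a x ∈ unitaryUnits ℂ := ph_mem_unitaryUnits _

/-- `g_a(x) ∈ {|u| ≤ 1, |u⁻¹| ≤ 1}`. [folklore] -/
private theorem gw_mem_U1 (a : ℝ) : ∀ x : Site d, gw i₀ i₁ a x ∈ U1 ℂ := fun _ => ph_mem_U1 _

/-- **`U₀` is `U(1)`-valued.** [cite: Balaban1985RegularSpaces, p.76 (gauge group G)] -/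
theorem U0_mem_unitaryUnits (a : ℝ) (x : Site d) (κ : Fin d) : U0 i₀ i₁ a x κ ∈ unitaryUnits ℂ := by
  rw [U0_apply]
  exact ph_mem_unitaryUnits _

/-- **`U₀ ∈ 𝔄_k({Ω_j}, α₀)` for every family, every `k`, `η > 0` and EVERY `α₀ > 0`** — a pure gauge has `U₀(∂p) = 1` and
`D*∂U₀ = 0` ((1.7), (1.9) with left side `0`: `B8Prop6OfThm4.one_inAk` and the gauge invariance of `𝔄_k`, p. 77,
`B8Ineq132.inAk_gaugeAct_iff`); in particular for the half-space family `B8Prop7HalfSpace.OmegaHS i₀`.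
[cite: Balaban1985RegularSpaces, (1.7), (1.9) p.77, p.77 (last paragraph: gauge invariance of 𝔄_k)] -/
theorem U0_inAk (a : ℝ) {L : ℕ} (hL : 1 ≤ L) (k : ℕ) {η α₀ : ℝ} (hη : 0 < η) (hα : 0 < α₀)
    (Ω : ℕ → Set (Site d)) : InAk L k η α₀ Ω (U0 i₀ i₁ a) :=
  (inAk_gaugeAct_iff L k η α₀ Ω (gw_mem_U1 a) 1).2 (one_inAk hL k hη hα Ω)

/-- **Level 0 of (1.126) for `U₀`, on every bond**: `|U₀(b) − 1| ≤ |e^{ia} − 1|` (`|m(b₋) − m(b₊)| ≤ 1`).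
[cite: Balaban1985RegularSpaces, (1.126) p.97 (j = 0)] -/
theorem norm_U0_sub_one_le (a : ℝ) (x : Site d) (κ : Fin d) :
    ‖((U0 i₀ i₁ a x κ : ℂˣ) : ℂ) - 1‖ ≤ ‖((ph a : ℂˣ) : ℂ) - 1‖ := by
  rw [U0_apply]
  have hcast : (prof i₀ i₁ x : ℝ) - prof i₀ i₁ (x + e κ) = ((prof i₀ i₁ x - prof i₀ i₁ (x + e κ) : ℤ) : ℝ) := by
    push_cast
    ring
  rw [hcast]
  rcases prof_step (i₀ := i₀) (i₁ := i₁) x κ with h | h | h <;> rw [h]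
  · rw [Int.cast_neg, Int.cast_one, mul_neg, mul_one, norm_ph_neg_sub_one]
  · rw [Int.cast_zero, mul_zero, ph_zero, Units.val_one, sub_self, norm_zero]
    exact norm_nonneg _
  · rw [Int.cast_one, mul_one]

/-- **`Ū₀¹ = 1`**: by the covariance (11) of [3] (`B7AvgGaugeCovariance.avgIter_gaugeAct`; its Prop. 2 smallness holds
since `1(∂p) = 1`) `\overline{1^{g}}¹ = (1̄¹)^{g(L·)} = 1^{g(L·)}`, and `g_a(Lz) = 1` (`m(Lz) = 0`).
[cite: Balaban1985Averaging, (11) p.19, p.24, (43) p.24; Balaban1985RegularSpaces, (1.126) p.97 (j = 1)] -/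
theorem avgIter_U0_one (a : ℝ) {L : ℕ} (hL : 2 ≤ L) : avgIter L (U0 i₀ i₁ a) 1 = 1 := by
  have hc : 0 < C0 d := C0_pos d
  have hc' : 0 < c2' d L := c2'_pos d L (by omega)
  set α₀ : ℝ := min (1 / (3 * C0 d)) (c2' d L / 2) with hα₀
  have hα : 0 < α₀ := lt_min (by positivity) (by positivity)
  have hα3 : C0 d * α₀ ≤ 1 / 3 := by
    have : α₀ ≤ 1 / (3 * C0 d) := min_le_left _ _
    rw [le_div_iff₀ (by positivity)] at this
    linarith
  have hα2 : 2 * α₀ ≤ c2' d L := by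
    have : α₀ ≤ c2' d L / 2 := min_le_right _ _
    linarith
  have hpdev : pdev (1 : Site d → Fin d → ℂˣ) = 0 := by
    unfold pdev
    simp [hol_one]
  have h52 : pdev (1 : Site d → Fin d → ℂˣ) < α₀ * (((L : ℝ) ^ 1)⁻¹) ^ 2 := by
    rw [hpdev]
    have : (0 : ℝ) < L := by exact_mod_cast (show 0 < L by omega)
    positivity
  have hcov := avgIter_gaugeAct L hL (avgClosed_unitaryUnits d L) 1 (1 : Site d → Fin d → ℂˣ)
    (fun _ _ => one_mem _) (gw_mem_U1 (i₀ := i₀) (i₁ := i₁) a) hα hα3 hα2 h52 1 le_rfl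
  rw [U0, hcov, avgIter_one]
  funext z κ
  simp only [gaugeAct, uLev, pow_one, Pi.one_apply, mul_one]
  simp only [gw, prof_smul hL, Int.cast_zero, mul_zero, ph_zero, inv_one, mul_one]

/-- **(1.126) holds for `U₀` with `α₁(a)`**, `0 < a ≤ 1`, `L ≥ 2` — for every family `Λ` (indeed on every bond of both
levels). [cite: Balaban1985RegularSpaces, (1.126) p.97] -/
theorem holds126_U0 {a : ℝ} (ha : 0 < a) (ha1 : a ≤ 1) {L : ℕ} (hL : 2 ≤ L) (Λ : ℕ → Set (Site d)) :
    Holds126 L 1 Λ (alpha1 a) (U0 i₀ i₁ a) := by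
  have hlt := norm_ph_lt ha ha1
  intro j hj z κ _
  rcases Nat.le_one_iff_eq_zero_or_eq_one.mp hj with rfl | rfl
  · rw [avgIter_zero]
    refine (norm_U0_sub_one_le a z κ).trans_lt ?_
    unfold alpha1
    linarith
  · rw [avgIter_U0_one a hL, Pi.one_apply, Pi.one_apply, Units.val_one, sub_self, norm_zero]
    unfold alpha1
    linarith [norm_nonneg (((ph a : ℂˣ) : ℂ) - 1)]

/-- `0 < α₁(a) < 3a/2` for `0 < a ≤ 1` — so `α₀ + α₁ ≤ c₁` is met for small `a` (and any `α₀`, `U0_inAk`).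
[cite: Balaban1985RegularSpaces, p.97 («if α₀ + α₁ ≤ c₁»)] -/
theorem alpha1_bounds {a : ℝ} (ha : 0 < a) (ha1 : a ≤ 1) : 0 < alpha1 a ∧ alpha1 a < 3 * a / 2 := by
  have h' := norm_ph_lt ha ha1
  -- `|e^{ia} − 1| = 2 sin(a/2) < a`, `|e^{2ia} − 1| = 2 sin a < 2a` (`sin x < x`)
  have hs : 0 < Real.sin (a / 2) :=
    Real.sin_pos_of_pos_of_lt_pi (by positivity) (by linarith [Real.pi_gt_three])
  have hs' : 0 < Real.sin a := Real.sin_pos_of_pos_of_lt_pi ha (by linarith [Real.pi_gt_three])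
  have h1 : ‖((ph a : ℂˣ) : ℂ) - 1‖ < a := by
    rw [norm_ph_sub_one, abs_of_pos hs]
    linarith [Real.sin_lt (x := a / 2) (by positivity)]
  have h2 : ‖((ph (2 * a) : ℂˣ) : ℂ) - 1‖ < 2 * a := by
    rw [norm_ph_sub_one, show 2 * a / 2 = a by ring, abs_of_pos hs']
    linarith [Real.sin_lt ha]
  unfold alpha1
  constructor
  · linarith [norm_nonneg (((ph a : ℂˣ) : ℂ) - 1)]
  · linarith

/-! ## §4 The failure on the bond `b* = ⟨e_{i₁} − e_{i₀}, e_{i₁}⟩` for EVERY admissible `u₀` -/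

/-- **The pinned value.**  For every `u₀` with (1.14) such that `U₀^{u₀⁻¹} ∈ Ax_1(𝔅_1, 1)` (the tree's
`B8Eq119TwistedAxial.InAx L 1 Λ 1`, = (1.15) below `Λ₁`, `inAx_one_iff`): (1.15) in the block of `0 ∈ Λ₁` on the tree
contour `Γ_{0, e_{i₁}}` gives `u₀⁻¹(e_{i₁}) g_a(e_{i₁}) = u₀⁻¹(0) g_a(0) = 1`, hence on `b* = ⟨x*, x* + e_{i₀}⟩ = ⟨e_{i₁} − e_{i₀}, e_{i₁}⟩`
(`u₀(x*) = 1` as `x* ∈ Λ₀`): `U₀^{u₀⁻¹}(b*) = g_a(x*) = e^{2ia}`, so `|U₀^{u₀⁻¹}(b*) − 1| = |e^{2ia} − 1|`.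
[cite: Balaban1985RegularSpaces, p.97 (sentence after (1.127)), (1.14)–(1.15) p.78, (1.19) p.79] -/
theorem norm_crossing_eq {L : ℕ} (hL : 2 ≤ L) (hi : i₀ ≠ i₁) (a : ℝ) {u₀ : Site d → ℂˣ}
    (h14 : Fixes114 L 1 (Lam i₀) u₀) (hAx : InAx L 1 (Lam i₀) 1 (gaugeAct u₀⁻¹ (U0 i₀ i₁ a))) :
    ‖((gaugeAct u₀⁻¹ (U0 i₀ i₁ a) (xstar i₀ i₁) i₀ : ℂˣ) : ℂ) - 1‖ = ‖((ph (2 * a) : ℂˣ) : ℂ) - 1‖ := by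
  have key : gaugeAct u₀⁻¹ (U0 i₀ i₁ a) = gaugeAct (u₀⁻¹ * gw i₀ i₁ a) 1 := by
    rw [U0, gaugeAct_mul]
  rw [key] at hAx ⊢
  rw [inAx_one_iff] at hAx
  -- (1.15) in the block of `0 ∈ Λ₁`, contour `Γ_{0, e_{i₁}}`
  have hax := hAx 1 le_rfl le_rfl 0 zero_mem_Lam_one 0 Nat.zero_lt_one 0 ((under_zero_iff L 0 0).2 rfl)
    (rstar hL i₁)
  rw [avgIter_zero, smul_zero, zero_add, boxVec_rstar, axialFn_gaugeAct, axialFn_one, mul_one] at hax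
  -- (1.14): `u₀(0) = 1` (`0 = L·0`, `0 ∈ Λ₁`) and `u₀(x*) = 1` (`x* ∈ Λ₀`)
  have hu0 : u₀ 0 = 1 := by simpa [uLev] using h14 1 le_rfl 0 zero_mem_Lam_one
  have hux : u₀ (xstar i₀ i₁) = 1 := by simpa [uLev] using h14 0 (Nat.zero_le 1) _ (xstar_mem hi)
  have hv0 : (u₀⁻¹ * gw i₀ i₁ a) 0 = 1 := by
    simp [hu0, gw, prof_zero, ph_zero]
  rw [hv0, one_mul, inv_eq_one] at hax
  -- the value on `b*`
  have hval : gaugeAct (u₀⁻¹ * gw i₀ i₁ a) 1 (xstar i₀ i₁) i₀ = ph (2 * a) := by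
    simp only [gaugeAct, Pi.one_apply, mul_one]
    rw [xstar_add_e, hax, inv_one, mul_one, Pi.mul_apply, Pi.inv_apply, hux, inv_one, one_mul, gw,
      prof_xstar hi]
    congr 1
    push_cast
    ring
  rw [hval]

/-- **The «hence» fails**: for `0 < a ≤ 1`, `L ≥ 2`, `i₀ ≠ i₁` and EVERY `u₀` with (1.14) and `U₀^{u₀⁻¹} ∈ Ax_1(𝔅_1, 1)`,
the configuration `U₀^{u₀⁻¹}` violates (1.126) (p. 77 convention) at `j = 0` on the bond `b*` of `Λ₀` — although `U₀`
satisfies (1.126) (`holds126_U0`) and lies in `𝔄₁({Ω_j}, α₀)` for every `α₀` (`U0_inAk`).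
[cite: Balaban1985RegularSpaces, p.97 (sentence after (1.127)), (1.126) p.97, p.77 (bond convention)] -/
theorem not_holds126_fixed {a : ℝ} (ha : 0 < a) (ha1 : a ≤ 1) {L : ℕ} (hL : 2 ≤ L) (hi : i₀ ≠ i₁)
    {u₀ : Site d → ℂˣ} (h14 : Fixes114 L 1 (Lam i₀) u₀) (hAx : InAx L 1 (Lam i₀) 1 (gaugeAct u₀⁻¹ (U0 i₀ i₁ a))) :
    ¬ Holds126 L 1 (Lam i₀) (alpha1 a) (gaugeAct u₀⁻¹ (U0 i₀ i₁ a)) := by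
  intro h
  have hb : BondTouches (Lam i₀ 0) (xstar i₀ i₁) i₀ := Or.inl (xstar_mem hi)
  have h0 := h 0 (Nat.zero_le 1) (xstar i₀ i₁) i₀ hb
  rw [avgIter_zero, norm_crossing_eq hL hi a h14 hAx] at h0
  have hlt := norm_ph_lt ha ha1
  unfold alpha1 at h0
  linarith

/-- The canonical `u₀`: `u₀ = g_a ĝ⁻¹` with `ĝ = 1` on `B(Λ₁) = {0 ≤ x_{i₀}}` and `ĝ = g_a` on `Λ₀`, so that
`U₀^{u₀⁻¹} = 1^{ĝ}`. [cite: Balaban1985RegularSpaces, (1.14)–(1.15) p.78 — witness data] -/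
private noncomputable def ghat (i₀ i₁ : Fin d) (a : ℝ) (x : Site d) : ℂˣ := if 0 ≤ x i₀ then 1 else gw i₀ i₁ a x

/-- **Such `u₀` exist** (p. 78: (1.15) «together with (1.14) … determine uniquely an element in each orbit»): the
`U(1)`-valued `u₀ = g_a ĝ⁻¹` satisfies (1.14) and `U₀^{u₀⁻¹} = 1^{ĝ} ∈ Ax_1(𝔅_1, 1)` (`ĝ ≡ 1` on every block `B(z)`, `z ∈ Λ₁`).
So `not_holds126_fixed` is not vacuous. [cite: Balaban1985RegularSpaces, (1.14)–(1.15) p.78, (1.19) p.79] -/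
theorem exists_fixed (a : ℝ) {L : ℕ} (hL : 2 ≤ L) (i₀ i₁ : Fin d) :
    ∃ u₀ : Site d → ℂˣ, (∀ x, u₀ x ∈ unitaryUnits ℂ) ∧ Fixes114 L 1 (Lam i₀) u₀ ∧
      InAx L 1 (Lam i₀) 1 (gaugeAct u₀⁻¹ (U0 i₀ i₁ a)) := by
  refine ⟨fun x => gw i₀ i₁ a x * (ghat i₀ i₁ a x)⁻¹, fun x => ?_, ?_, ?_⟩
  · refine (unitaryUnits ℂ).mul_mem (gw_mem_unitaryUnits a x) ((unitaryUnits ℂ).inv_mem ?_)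
    unfold ghat
    split_ifs
    · exact one_mem _
    · exact gw_mem_unitaryUnits a x
  · intro j hj y hy
    rcases Nat.le_one_iff_eq_zero_or_eq_one.mp hj with rfl | rfl
    · have hy' : ¬ 0 ≤ y i₀ := not_le.2 ((mem_Lam_zero i₀ y).1 hy)
      simp [uLev, ghat, hy']
    · have hy' : 0 ≤ ((L : ℤ) • y) i₀ := smul_apply_nonneg ((mem_Lam_one i₀ y).1 hy)
      have hg : gw i₀ i₁ a ((L : ℤ) ^ 1 • y) = 1 := by
        rw [pow_one, gw, prof_smul hL, Int.cast_zero, mul_zero, ph_zero]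
      have hgh : ghat i₀ i₁ a ((L : ℤ) ^ 1 • y) = 1 := by
        rw [pow_one]
        unfold ghat
        rw [if_pos hy']
      simp only [uLev, hg, hgh, inv_one, mul_one]
  · have key : gaugeAct (fun x => gw i₀ i₁ a x * (ghat i₀ i₁ a x)⁻¹)⁻¹ (U0 i₀ i₁ a) = gaugeAct (ghat i₀ i₁ a) 1 := by
      rw [U0, gaugeAct_mul]
      congr 1
      funext x
      simp [mul_comm]
    rw [key, inAx_one_iff]
    intro j hj1 hj2 xj hxj n hn z hz r
    obtain rfl : j = 1 := le_antisymm hj2 hj1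
    obtain rfl : n = 0 := Nat.lt_one_iff.mp hn
    obtain rfl : z = xj := (under_zero_iff L xj z).1 (by simpa using hz)
    have h1 : 0 ≤ ((L : ℤ) • z) i₀ := smul_apply_nonneg ((mem_Lam_one i₀ z).1 hxj)
    have h2 : 0 ≤ ((L : ℤ) • z + boxVec L r) i₀ := by
      have : 0 ≤ boxVec L r i₀ := by simp [boxVec]
      simp only [Pi.add_apply]
      positivity
    have e1 : ghat i₀ i₁ a ((L : ℤ) • z) = 1 := by
      unfold ghat
      rw [if_pos h1]
    have e2 : ghat i₀ i₁ a ((L : ℤ) • z + boxVec L r) = 1 := by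
      unfold ghat
      rw [if_pos h2]
    rw [avgIter_zero, axialFn_gaugeAct, axialFn_one, mul_one, e1, e2, inv_one, mul_one]

/-- **HEADLINE (cell GAPS G-B8-18).**  On the half-space family `Ω₀ = ℤᵈ ⊃ Ω₁ = {0 ≤ x_{i₀}}` (`k = 1`, `L ≥ 2`, a second
direction `i₁ ≠ i₀`), for every `ε > 0` there are a `U(1)`-valued `U₀` and `0 < α₁ < ε` such that: `U₀ ∈ 𝔄₁({Ω_j}, α₀)`
for every `α₀ > 0` (and every `η > 0`); `U₀` satisfies (1.126) at `α₁`; gauge transformations `u₀` with (1.14) putting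
`U₀^{u₀⁻¹}` into `Ax_1(𝔅_1, 1)` exist; and for EVERY such `u₀` the configuration `U₀^{u₀⁻¹}` violates (1.126) at `α₁`
(p. 77 convention; the violation sits on the level-0 bond `⟨e_{i₁} − e_{i₀}, e_{i₁}⟩` leaving `Λ₀`, `norm_crossing_eq`).
[cite: Balaban1985RegularSpaces, p.97 (sentence after (1.127)), (1.126) p.97, (1.14)–(1.15) p.78, p.77 (bond convention)] -/
theorem p97_transfer_fails {L : ℕ} (hL : 2 ≤ L) {i₀ i₁ : Fin d} (hi : i₀ ≠ i₁) {ε : ℝ} (hε : 0 < ε) :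
    ∃ (U₀ : Site d → Fin d → ℂˣ) (α₁ : ℝ), 0 < α₁ ∧ α₁ < ε ∧ (∀ x κ, U₀ x κ ∈ unitaryUnits ℂ) ∧
      (∀ {η α₀ : ℝ}, 0 < η → 0 < α₀ → InAk L 1 η α₀ (OmegaHS i₀) U₀) ∧
      Holds126 L 1 (Lam i₀) α₁ U₀ ∧
      (∃ u₀ : Site d → ℂˣ, (∀ x, u₀ x ∈ unitaryUnits ℂ) ∧ Fixes114 L 1 (Lam i₀) u₀ ∧
        InAx L 1 (Lam i₀) 1 (gaugeAct u₀⁻¹ U₀)) ∧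
      ∀ u₀ : Site d → ℂˣ, Fixes114 L 1 (Lam i₀) u₀ → InAx L 1 (Lam i₀) 1 (gaugeAct u₀⁻¹ U₀) →
        ¬ Holds126 L 1 (Lam i₀) α₁ (gaugeAct u₀⁻¹ U₀) := by
  set a : ℝ := min 1 (ε / 2) with ha_def
  have ha : 0 < a := lt_min one_pos (by positivity)
  have ha1 : a ≤ 1 := min_le_left _ _
  have haε : a ≤ ε / 2 := min_le_right _ _
  obtain ⟨hpos, hlt⟩ := alpha1_bounds ha ha1
  exact ⟨U0 i₀ i₁ a, alpha1 a, hpos, by linarith, U0_mem_unitaryUnits a,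
    fun hη hα => U0_inAk a (by omega) 1 hη hα _, holds126_U0 ha ha1 hL _, exists_fixed a hL i₀ i₁,
    fun u₀ h14 hAx => not_holds126_fixed ha ha1 hL hi h14 hAx⟩

end Witness

end Literature.MathematicalPhysics.QuantumFieldTheory.Balaban1983to89.B8Eq1126AxialWitness
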